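import Summits.QuantumFields.YangMills.Theorems.BalabanUVNodesN18AtU3OfKernels
import Summits.QuantumFields.YangMills.Theorems.BalabanUVNodesN18U3TowerGuards

/-!
# BalabanUVNodes ∕ N18 — A MODEL INHABITANT of the family-reduction letters of `…N18AtU3OfKernels` §1 on node00-def-W1's KERNEL CARRIER:
# an ω-weighted history functional that is COUPLING-SENSITIVE over the boxes (passes dag-n18-w2's guard), carries NE9 with FADING MEMORY,
# and NE5 at ONE member with a POSITIVE constant — so the generic reduction `ne5_family_of_member` FIRES non-vacuously (referee standard A6)
# (Track A, DAG node N18 = NE5; cluster K4 «SpineRates»; key K3⁷ `SpineGivenEndpointR13SepCoPH`; count-neutral)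

HONEST FRAMING.  Count-neutral kernel bookkeeping (seat `pub-ymgap-dag-n18-w1` g2; `--supports stmt-QuantumFields-20544`, helper lane): a MODEL functional
on W1-19's carrier `U3OfKernels.carriers` — `E_ω g (k,μ,ν,z) := e^{−κ|z|₁}·Σ_{i≤k} ω^{k+1−i} g_i` with run B's family `E_ω (b ∷ g)` one level up — NOT
Bałaban's kernels, NOT a term family's `polLimit`; it certifies only that the hypothesis set of the generic family reduction {link, window
compatibility, NE9, fading memory, `0 ≤ ω ≤ θ ≤ 1`, NE5 at one member} is JOINTLY SATISFIABLE together with dag-n18-w2's sensitivity guard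
`SensitiveOnBoxes` and a positive NE5 constant (`γω`).  Nothing of Bałaban's is asserted; N18 NOT discharged; K3⁷ OPEN; counts unmoved; nothing
continuum ∕ ℝ⁴ ∕ OS ∕ mass gap ∕ Clay.  THEOREMS ONLY: 0 `def` (the model functional is written as a λ-term), 0 `sorry`, standard axioms.

THE MODEL.  On `carriers` (`Dom = ℕ × Fin 4 × Fin 4 × (Fin 4 → ℤ)`, scale `k + 1`, tree length `|z|₁`, one-point backgrounds): run A's functional
`E_ω g _ p := e^{−κ|z|₁}·Σ_{i<k+1} ω^{k+1−i}·g i` (`p = (k,μ,ν,z)`), run B's family `F_ω b g _ p := E_ω (b ∷ g) _ (k+1,μ,ν,z)`.  Then: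
`model_link` (the prepend-shift link, `rfl`) · `model_ne9` (NE9 on every window with moduli `Λ a i = ω^{a−i}`, from `|Σ| ≤ Σ|·|`) ·
`model_fadingMemory` (`C₉ = 1`) · `model_sub` (the two runs DIFFER EXACTLY by the oldest coupling's weight: `E_ω g − F_ω b g = −e^{−κ|z|₁}·ω^{k+2}·b`) ·
`model_ne5_member` (NE5 at ANY member `b₀ ∈ ]0, γ]` with rate `ω` and constant `γω`) · `model_family` (§1's `ne5_family_of_member` FIRES: every member,
constant `γω + 1·γ`) · `model_sensitiveOnBoxes` (`ω ≠ 0`, `γ > 0` ⟹ the functional passes the guard: at step `0` the box histories `γ` and `γ∕2`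
give different slices).  So the reduction's letters are compatible with a non-degenerate, coupling-sensitive run-A functional.

Sources (types only): T. Bałaban, CMP **109** (1987) [Balaban1987RG1] Thm 1 p. 259, (1.20)–(1.22) p. 264, §5 p. 298.  Nothing here is a claim about
the Yang–Mills mass gap.
-/

noncomputable section

namespace YMDAG.N18.AtU3OfKernels.Model

open scoped BigOperators
open Literature.MathematicalPhysics.QuantumFieldTheory.Balaban1983to89
open Literature.MathematicalPhysics.QuantumFieldTheory.Balaban1983to89.T4OutputRate (Carriers Functional Window NE5 NE9 FadingMemory)
open Literature.MathematicalPhysics.QuantumFieldTheory.Balaban1983to89.B12Sec2to5 (l1)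
open Literature.MathematicalPhysics.QuantumFieldTheory.Balaban1983to89.FlowStep (Box mem_box)
open Literature.MathematicalPhysics.QuantumFieldTheory.Balaban1983to89.T4FlagMemory (extd extd_coe)
open Node00 (prependCoupling prependCoupling_zero prependCoupling_succ)
open Node00.U3OfKernels (carriers pt prependCoupling_mem_window)
open YMDAG.N18.U3Guards (SensitiveOnBoxes)
open YMDAG.N18.AtU3OfKernels (ne5_family_of_member)

/-- **THE LINK** (`rfl`): the model's run-B family is its run-A functional along the prepended sequence at the level-shifted point.
[cite: Balaban1987RG1, (0.24)–(0.25) p.257] -/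
theorem model_link (κ ω : ℝ) (b : ℝ) (g : ℕ → ℝ) (U : PUnit) (p : carriers.Dom) :
    (fun (b : ℝ) (g : ℕ → ℝ) (_ : PUnit) (p : carriers.Dom) =>
        Real.exp (-(κ * l1 p.2.2.2)) * ∑ i ∈ Finset.range (p.1 + 1 + 1), ω ^ (p.1 + 1 + 1 - i) * prependCoupling b g i) b g U p =
      (fun (g : ℕ → ℝ) (_ : PUnit) (p : carriers.Dom) =>
        Real.exp (-(κ * l1 p.2.2.2)) * ∑ i ∈ Finset.range (p.1 + 1), ω ^ (p.1 + 1 - i) * g i) (prependCoupling b g) U (p.1 + 1, p.2) :=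
  rfl

/-- **NE9 FOR THE MODEL** on every window, moduli `Λ a i = ω^{a−i}` (`0 ≤ ω`): `|Σ ω^{k+1−i}(g_i − g′_i)| ≤ Σ ω^{k+1−i}|g_i − g′_i|`.
[cite: Balaban1987RG1, §5 p.298] -/
theorem model_ne9 (κ ω : ℝ) (hω : 0 ≤ ω) (W : Set (ℕ → ℝ)) :
    NE9 (C := carriers) (fun (g : ℕ → ℝ) (_ : PUnit) (p : carriers.Dom) =>
        Real.exp (-(κ * l1 p.2.2.2)) * ∑ i ∈ Finset.range (p.1 + 1), ω ^ (p.1 + 1 - i) * g i) W κ (fun a i => ω ^ (a - i)) := by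
  rintro g - g' - U ⟨k, μ, ν, z⟩
  show |Real.exp (-(κ * l1 z)) * ∑ i ∈ Finset.range (k + 1), ω ^ (k + 1 - i) * g i -
      Real.exp (-(κ * l1 z)) * ∑ i ∈ Finset.range (k + 1), ω ^ (k + 1 - i) * g' i| ≤
    Real.exp (-(κ * l1 z)) * ∑ i ∈ Finset.range (k + 1), ω ^ (k + 1 - i) * |g i - g' i|
  have he := Real.exp_pos (-(κ * l1 z))
  rw [← mul_sub, ← Finset.sum_sub_distrib, abs_mul, abs_of_pos he]
  refine mul_le_mul_of_nonneg_left ((Finset.abs_sum_le_sum_abs _ _).trans (le_of_eq ?_)) he.le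
  refine Finset.sum_congr rfl fun i _ => ?_
  rw [← mul_sub, abs_mul, abs_of_nonneg (pow_nonneg hω _)]

/-- **FADING MEMORY OF THE MODEL's MODULI** (`C₉ = 1`). [cite: Balaban1987RG1, §5 p.298] -/
theorem model_fadingMemory (ω : ℝ) (hω : 0 ≤ ω) : FadingMemory 1 ω (fun a i => ω ^ (a - i)) :=
  fun a i _ => ⟨pow_nonneg hω _, by rw [one_mul]⟩

/-- **THE TWO RUNS OF THE MODEL DIFFER EXACTLY BY THE OLDEST COUPLING's WEIGHT**: at the point `(k,μ,ν,z)`,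
`E_ω g − F_ω b g = −e^{−κ|z|₁}·ω^{k+2}·b` (the prepended sum is `ω^{k+2} b + Σ_{i<k+1} ω^{k+1−i} g_i`). [folklore] -/
theorem model_sub (κ ω b : ℝ) (g : ℕ → ℝ) (k : ℕ) (z : Fin 4 → ℤ) :
    Real.exp (-(κ * l1 z)) * ∑ i ∈ Finset.range (k + 1), ω ^ (k + 1 - i) * g i -
        Real.exp (-(κ * l1 z)) * ∑ i ∈ Finset.range (k + 1 + 1), ω ^ (k + 1 + 1 - i) * prependCoupling b g i =
      -(Real.exp (-(κ * l1 z)) * ω ^ (k + 2) * b) := by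
  rw [Finset.sum_range_succ' (fun i => ω ^ (k + 1 + 1 - i) * prependCoupling b g i), prependCoupling_zero, Nat.sub_zero]
  have hs : ∑ i ∈ Finset.range (k + 1), ω ^ (k + 1 + 1 - (i + 1)) * prependCoupling b g (i + 1) =
      ∑ i ∈ Finset.range (k + 1), ω ^ (k + 1 - i) * g i := by
    refine Finset.sum_congr rfl fun i _ => ?_
    rw [prependCoupling_succ, Nat.add_sub_add_right]
  rw [hs]
  ring

/-- **NE5 AT ONE (INDEED ANY) MEMBER FOR THE MODEL**: for `b₀ ∈ ]0, γ]`, `0 ≤ ω`, rate `ω` and constant `γω`: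
`|E_ω g − F_ω b₀ g| = e^{−κ|z|₁}ω^{k+2}b₀ ≤ (γω)·ω^{k+1}·e^{−κ|z|₁}`. [cite: Balaban1987RG1, Thm 1 p.259] -/
theorem model_ne5_member (κ ω γ : ℝ) (hω : 0 ≤ ω) {b₀ : ℝ} (hb₀ : 0 < b₀) (hb₀γ : b₀ ≤ γ) (W : Set (ℕ → ℝ)) :
    NE5 (C := carriers)
      (fun (g : ℕ → ℝ) (_ : PUnit) (p : carriers.Dom) =>
        Real.exp (-(κ * l1 p.2.2.2)) * ∑ i ∈ Finset.range (p.1 + 1), ω ^ (p.1 + 1 - i) * g i)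
      ((fun (b : ℝ) (g : ℕ → ℝ) (_ : PUnit) (p : carriers.Dom) =>
        Real.exp (-(κ * l1 p.2.2.2)) * ∑ i ∈ Finset.range (p.1 + 1 + 1), ω ^ (p.1 + 1 + 1 - i) * prependCoupling b g i) b₀)
      W κ ω (γ * ω) := by
  rintro g - U ⟨k, μ, ν, z⟩
  show |Real.exp (-(κ * l1 z)) * ∑ i ∈ Finset.range (k + 1), ω ^ (k + 1 - i) * g i -
      Real.exp (-(κ * l1 z)) * ∑ i ∈ Finset.range (k + 1 + 1), ω ^ (k + 1 + 1 - i) * prependCoupling b₀ g i| ≤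
    γ * ω * ω ^ (k + 1) * Real.exp (-(κ * l1 z))
  rw [model_sub κ ω b₀ g k z, abs_neg]
  have he := Real.exp_pos (-(κ * l1 z))
  rw [abs_of_nonneg (mul_nonneg (mul_nonneg he.le (pow_nonneg hω _)) hb₀.le)]
  calc Real.exp (-(κ * l1 z)) * ω ^ (k + 2) * b₀
      ≤ Real.exp (-(κ * l1 z)) * ω ^ (k + 2) * γ :=
        mul_le_mul_of_nonneg_left hb₀γ (mul_nonneg he.le (pow_nonneg hω _))
    _ = γ * ω * ω ^ (k + 1) * Real.exp (-(κ * l1 z)) := by ring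

/-- **THE GENERIC FAMILY REDUCTION FIRES ON THE MODEL** (`…N18AtU3OfKernels.ne5_family_of_member`, every hypothesis discharged by the model's
own letters; `0 ≤ ω ≤ 1`, `b₀ ∈ ]0, γ]`): NE5 at EVERY member on the window `]0, γ]^ℕ` with constant `γω + 1·γ`. [cite: Balaban1987RG1, Thm 1 p.259 and §5 p.298] -/
theorem model_family (κ ω γ : ℝ) (hω : 0 ≤ ω) (hω1 : ω ≤ 1) {b₀ : ℝ} (hb₀ : 0 < b₀) (hb₀γ : b₀ ≤ γ) :
    ∀ b : ℝ, 0 < b → b ≤ γ → NE5 (C := carriers)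
      (fun (g : ℕ → ℝ) (_ : PUnit) (p : carriers.Dom) =>
        Real.exp (-(κ * l1 p.2.2.2)) * ∑ i ∈ Finset.range (p.1 + 1), ω ^ (p.1 + 1 - i) * g i)
      ((fun (b : ℝ) (g : ℕ → ℝ) (_ : PUnit) (p : carriers.Dom) =>
        Real.exp (-(κ * l1 p.2.2.2)) * ∑ i ∈ Finset.range (p.1 + 1 + 1), ω ^ (p.1 + 1 + 1 - i) * prependCoupling b g i) b)
      (Window γ) κ ω (γ * ω + 1 * γ) :=
  ne5_family_of_member (C := carriers) (C' := carriers) _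
    (fun (g : ℕ → ℝ) (_ : PUnit) (p : carriers.Dom) =>
      Real.exp (-(κ * l1 p.2.2.2)) * ∑ i ∈ Finset.range (p.1 + 1), ω ^ (p.1 + 1 - i) * g i)
    _ (fun p => (p.1 + 1, p.2)) id (fun _ => Nat.le_succ _) (fun _ => rfl) (model_link κ ω)
    (fun _ hb hbγ _ hg => prependCoupling_mem_window hb hbγ hg) (model_ne9 κ ω hω (Window γ)) (model_fadingMemory ω hω) hω
    le_rfl hω1 hb₀ hb₀γ (model_ne5_member κ ω γ hω hb₀ hb₀γ (Window γ))

/-- **THE MODEL PASSES dag-n18-w2's GUARD**: for `ω ≠ 0`, `γ > 0` the run-A functional is COUPLING-SENSITIVE over the γ-boxes — at step `0` the box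
histories `γ` and `γ∕2` give the slices `e^{0}·ω·γ ≠ e^{0}·ω·γ∕2` at the point `(0,0,0,0)`. [folklore] -/
theorem model_sensitiveOnBoxes (κ ω γ : ℝ) (hω : ω ≠ 0) (hγ : 0 < γ) :
    SensitiveOnBoxes (C := carriers)
      (fun (g : ℕ → ℝ) (_ : PUnit) (p : carriers.Dom) =>
        Real.exp (-(κ * l1 p.2.2.2)) * ∑ i ∈ Finset.range (p.1 + 1), ω ^ (p.1 + 1 - i) * g i) γ := by
  refine ⟨0, fun _ => γ, fun _ => γ / 2, mem_box.mpr fun _ => ⟨hγ, le_rfl⟩,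
    mem_box.mpr fun _ => ⟨by linarith, by linarith⟩, fun h => ?_⟩
  have h0 := congrFun (congrFun h PUnit.unit) ((0 : ℕ), (0 : Fin 4), (0 : Fin 4), (0 : Fin 4 → ℤ))
  have hl : l1 (0 : Fin 4 → ℤ) = 0 := by simp [l1]
  have e : ∀ c : ℝ, extd (fun _ : Fin (0 + 1) => c) 0 = c := fun c => by simp [extd]
  simp only [hl, mul_zero, neg_zero, Real.exp_zero, one_mul, zero_add, Finset.sum_range_one, Nat.sub_zero, pow_one, e] at h0
  have h1 : γ = γ / 2 := mul_left_cancel₀ hω h0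
  linarith

end YMDAG.N18.AtU3OfKernels.Model

end
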